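import Summits.BirchSwinnertonDyer.BirchSwinnertonDyer.Theorems.ManinLocalTwoThreeParamPoleJTwist
import Summits.BirchSwinnertonDyer.BirchSwinnertonDyer.Theorems.ManinLocalTwoThreeRationalDescent
import Literature.NumberTheory.EllipticCurves.ModularParamXRationality
import Literature.NumberTheory.EllipticCurves.LatticeInclusionRigidityProofs
import HarnessLib

/-!
# A RATIONAL algebraic relation `Φ(j, x) = 0` for `x = ℘_Λ(2πi∫f)`, non-degenerate in `x`

Cell `bsd-f2-manin`, prover seat p3 (gen 16), crux C3 `ManinPrimeToThreeAtNine` (stmt-22968), piece (ALG)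
`UDCKummerWitnessLine.KummerPoleValuesAlgebraic` of skeleton v25 (algebraic `j`-values on the fibres of the modular
parametrisation over the points `y_W = 0`).  For `f ∈ S₂(Γ₀(N))` nonzero with rational Fourier coefficients and a
presentation `x·G = F` of `x = ℘_Λ(u)` (`Λ ⊇ Λ_f`, `g₂, g₃ ∈ ℚ`):

* `exists_ratCast_coeff_xFn` — the Laurent `q`-series `x̂ = F̂/Ĝ` has RATIONAL coefficients (tree
  `IsXPresentation.mapLaurent_xFn`: fixed by every `σ ∈ Aut ℂ`, + `exists_ratCast_eq_of_forall_ringEquiv`);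
* `exists_rat_relation` — there are `d, D` and `y : Fin (d+1) × Fin (D+1) → ℚ`, `y ≠ 0`, with
  `Σ y(i,k)·ĵᵏ·x̂ⁱ = 0` in `ℂ((q))` (the tree's COMPLEX relation `exists_polynomial_relation_kleinJL` — Sturm count —
  descended to `ℚ` by the C3 LEAD's `RationalDescent.exists_rat_of_complex_solution'`, the system being ℚ-linear because
  `ĵ, x̂ ∈ ℚ((q))`);
* `exists_rat_relation_nondegenerate` — such a relation of MINIMAL `x`-degree satisfies: for every `α ∈ ℂ` the
  polynomial `Φ(J, α) = Σ_k (Σ_i y(i,k)αⁱ) Jᵏ` is nonzero (else `minpoly_ℚ(α)(X)` divides `Φ` and `minpoly(x̂) ≠ 0`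
  lowers the degree; `x̂` is not a constant since `|℘_Λ(u)| → ∞` at the cusp);
* `sum_kleinJ_pow_mul_weierstrassP_pow_eq_zero` — EVALUATION: off the poles and off the zeros of `G`,
  `Σ y(i,k)·j(τ)ᵏ·℘_Λ(u(τ))ⁱ = 0` (clear denominators by `Δ̂^D Ĝ^d`: a modular form with zero `q`-expansion vanishes).

Everything is proved; no named fact.  BSD is not proved by this; C2/C3 are not proved by this.
-/

set_option linter.dupNamespace false

noncomputable section

open Complex Filter Topology Set Function
open UpperHalfPlane hiding I
open scoped Real Topology Manifold MatrixGroups PeriodPair ModularForm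
open ModularForm EisensteinSeries SlashInvariantForm ModularFormClass CongruenceSubgroup PowerSeries
open Literature.NumberTheory.EllipticCurves Literature.NumberTheory.EllipticCurves.ModularForms

namespace Summit.BirchSwinnertonDyer.BirchSwinnertonDyer.Theorems.ManinLocalTwoThree.ParamPoleJ

variable {N : ℕ} [NeZero N]

/-! ### §1 Rational coefficients -/

omit [NeZero N] in
/-- A Laurent series fixed coefficientwise by every automorphism of `ℂ` has rational coefficients. [folklore] -/
theorem exists_ratCast_coeff_of_forall_mapLaurent {x : LaurentSeries ℂ}
    (h : ∀ σ : ℂ ≃+* ℂ, mapLaurent (σ : ℂ →+* ℂ) x = x) : ∃ r : ℤ → ℚ, ∀ s, ((r s : ℚ) : ℂ) = x.coeff s := by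
  have hs : ∀ s : ℤ, ∃ q : ℚ, (q : ℂ) = x.coeff s := fun s ↦
    exists_ratCast_eq_of_forall_ringEquiv fun σ ↦ by
      have := congrArg (fun y : LaurentSeries ℂ ↦ y.coeff s) (h σ)
      simpa [coeff_mapLaurent] using this
  choose r hr using hs
  exact ⟨r, hr⟩

omit [NeZero N] in
/-- `j` has a `σ`-fixed (integer) Laurent `q`-series. [folklore] -/
theorem mapLaurent_kleinJL (σ : ℂ →+* ℂ) : mapLaurent σ kleinJL = kleinJL := by
  have hE : (qExpansion 1 ⇑E₄cube).map σ = qExpansion 1 ⇑E₄cube := by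
    rw [E₄cube, ModularForm.qExpansion_mcast, ModularForm.qExpansion_pow one_pos one_mem_strictPeriods_SL, map_pow,
      (isRatQExp_E₄ σ).map_eq]
  have hΔ : (qExpansion 1 ⇑delta).map σ = qExpansion 1 ⇑delta := (isRatQExp_discriminant σ).map_eq
  rw [kleinJL, map_div₀, mapLaurent_coe_powerSeries, mapLaurent_coe_powerSeries, hE, hΔ]

/-- **The Laurent `q`-series `x̂ = F̂/Ĝ` of `x = ℘_Λ(2πi∫f)` has rational coefficients** (`f` rational,
`g₂, g₃ ∈ ℚ`; tree `IsXPresentation.mapLaurent_xFn`). [cite: ShimuraIATAF1971, §6.2 Prop. 6.9 and Thm. 7.14] -/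
theorem exists_ratCast_coeff_xFn {f : CuspForm (Gamma0 N) 2} {L : PeriodPair} {k : ℤ}
    {F G : CuspForm (Gamma0 N) k} (h : IsXPresentation f L F G) (hf : f ≠ 0)
    (hrat : ∀ m, ∃ q : ℚ, (q : ℂ) = cuspCoeff f m) (hg₂ : ∃ q : ℚ, (q : ℂ) = L.g₂) (hg₃ : ∃ q : ℚ, (q : ℂ) = L.g₃) :
    ∃ r : ℤ → ℚ, ∀ s, ((r s : ℚ) : ℂ) = ((h.xFn : modularFunctionField N) : LaurentSeries ℂ).coeff s := by
  obtain ⟨q₂, hq₂⟩ := hg₂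
  obtain ⟨q₃, hq₃⟩ := hg₃
  exact exists_ratCast_coeff_of_forall_mapLaurent fun σ ↦
    h.mapLaurent_xFn hf hrat σ (by rw [← hq₂, map_ratCast]) (by rw [← hq₃, map_ratCast])

/-! ### §2 A rational algebraic relation between `j` and `x` -/

/-- **A rational relation `Σ y(i,k) ĵᵏ x̂ⁱ = 0`, `y ≠ 0`** (Sturm count over `ℂ`, tree
`exists_polynomial_relation_kleinJL`, descended to `ℚ` by linear algebra, C3 LEAD `exists_rat_of_complex_solution'`).
[cite: ShimuraIATAF1971, Prop. 2.11] -/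
theorem exists_rat_relation {f : CuspForm (Gamma0 N) 2} {L : PeriodPair} {k : ℤ}
    {F G : CuspForm (Gamma0 N) k} (h : IsXPresentation f L F G) (hf : f ≠ 0)
    (hrat : ∀ m, ∃ q : ℚ, (q : ℂ) = cuspCoeff f m) (hg₂ : ∃ q : ℚ, (q : ℂ) = L.g₂) (hg₃ : ∃ q : ℚ, (q : ℂ) = L.g₃) :
    ∃ (d D : ℕ) (y : Fin (d + 1) × Fin (D + 1) → ℚ), y ≠ 0 ∧
      ∑ p : Fin (d + 1) × Fin (D + 1), HahnSeries.C ((y p : ℚ) : ℂ) *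
        (kleinJL ^ (p.2 : ℕ) * ((h.xFn : modularFunctionField N) : LaurentSeries ℂ) ^ (p.1 : ℕ)) = 0 := by
  classical
  set X : LaurentSeries ℂ := ((h.xFn : modularFunctionField N) : LaurentSeries ℂ) with hXdef
  -- the complex relation
  have hu : X * qExpansionL N (G : ModularForm (Gamma0 N) k) = qExpansionL N (F : ModularForm (Gamma0 N) k) :=
    mkFn_mul _ _ h.modularForm_ne_zero
  obtain ⟨c, hc0, hc⟩ := exists_polynomial_relation_kleinJL _ _ h.modularForm_ne_zero hu
  set D : ℕ := Finset.univ.sup fun i : Fin (gamma0Index N + 1) ↦ (c i).natDegree with hD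
  have hdeg : ∀ i, (c i).natDegree < D + 1 := fun i ↦
    Nat.lt_succ_of_le (Finset.le_sup (f := fun i : Fin (gamma0Index N + 1) ↦ (c i).natDegree) (Finset.mem_univ i))
  -- the complex solution `C (i, k) = (c i).coeff k`
  set Cc : Fin (gamma0Index N + 1) × Fin (D + 1) → ℂ := fun p ↦ (c p.1).coeff p.2 with hCc
  have hrel : ∑ p : Fin (gamma0Index N + 1) × Fin (D + 1),
      HahnSeries.C (Cc p) * (kleinJL ^ (p.2 : ℕ) * X ^ (p.1 : ℕ)) = 0 := by
    rw [← hc, Fintype.sum_prod_type]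
    refine Finset.sum_congr rfl fun i _ ↦ ?_
    rw [Polynomial.aeval_eq_sum_range' (hdeg i), ← Fin.sum_univ_eq_sum_range, Finset.sum_mul]
    refine Finset.sum_congr rfl fun k _ ↦ ?_
    rw [hCc, Algebra.smul_def, algebraMap_laurentSeries_apply, mul_assoc]
  -- rational coordinates of the monomials `ĵᵏ x̂ⁱ`
  obtain ⟨rX, hrX⟩ := exists_ratCast_coeff_xFn h hf hrat hg₂ hg₃
  have hmono : ∀ p : Fin (gamma0Index N + 1) × Fin (D + 1), ∀ σ : ℂ ≃+* ℂ,
      mapLaurent (σ : ℂ →+* ℂ) (kleinJL ^ (p.2 : ℕ) * X ^ (p.1 : ℕ)) = kleinJL ^ (p.2 : ℕ) * X ^ (p.1 : ℕ) := by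
    intro p σ
    obtain ⟨q₂, hq₂⟩ := hg₂
    obtain ⟨q₃, hq₃⟩ := hg₃
    rw [map_mul, map_pow, map_pow, mapLaurent_kleinJL, hXdef,
      h.mapLaurent_xFn hf hrat σ (by rw [← hq₂, map_ratCast]) (by rw [← hq₃, map_ratCast])]
  have hcoef : ∀ p : Fin (gamma0Index N + 1) × Fin (D + 1), ∃ r : ℤ → ℚ, ∀ s,
      ((r s : ℚ) : ℂ) = (kleinJL ^ (p.2 : ℕ) * X ^ (p.1 : ℕ)).coeff s := fun p ↦
    exists_ratCast_coeff_of_forall_mapLaurent (hmono p)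
  choose a ha using hcoef
  -- the ℚ-linear system, one equation per `q`-power
  have hsys : ∀ s : ℤ, ∑ p, ((a p s : ℚ) : ℂ) * Cc p = 0 := by
    intro s
    have := congrArg (fun y : LaurentSeries ℂ ↦ y.coeff s) hrel
    simp only [HahnSeries.coeff_sum, HahnSeries.C_mul_eq_smul, HahnSeries.coeff_smul, smul_eq_mul,
      HahnSeries.coeff_zero] at this
    rw [← this]
    refine Finset.sum_congr rfl fun p _ ↦ ?_
    rw [ha p s, mul_comm]
  -- some coordinate of the complex solution is nonzero
  have hne : ∃ t : Fin (gamma0Index N + 1) × Fin (D + 1),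
      ∑ p, ((if p = t then (1 : ℚ) else 0 : ℚ) : ℂ) * Cc p ≠ 0 := by
    obtain ⟨i, hi⟩ : ∃ i, c i ≠ 0 := by
      by_contra hall
      push Not at hall
      exact hc0 (funext hall)
    have hk : (c i).coeff (c i).natDegree ≠ 0 := Polynomial.leadingCoeff_ne_zero.mpr hi
    refine ⟨(i, ⟨(c i).natDegree, hdeg i⟩), ?_⟩
    rw [Finset.sum_eq_single (i, ⟨(c i).natDegree, hdeg i⟩) (fun p _ hp ↦ by simp [hp]) (by simp)]
    simpa [hCc] using hk
  obtain ⟨y, hy, t, hyt⟩ := RationalDescent.exists_rat_of_complex_solution' (fun s p ↦ a p s)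
    (fun t p ↦ if p = t then (1 : ℚ) else 0) Cc hsys hne
  refine ⟨gamma0Index N, D, y, ?_, ?_⟩
  · intro h0
    apply hyt
    simp [h0]
  · -- the rational relation, coefficient by coefficient
    apply HahnSeries.ext
    funext s
    simp only [HahnSeries.coeff_sum, HahnSeries.C_mul_eq_smul, HahnSeries.coeff_smul, smul_eq_mul,
      HahnSeries.coeff_zero]
    have := hy s
    calc ∑ p : Fin (gamma0Index N + 1) × Fin (D + 1), ((y p : ℚ) : ℂ) * (kleinJL ^ (p.2 : ℕ) * X ^ (p.1 : ℕ)).coeff s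
        = (((∑ p, a p s * y p : ℚ)) : ℂ) := by
          rw [Rat.cast_sum]
          refine Finset.sum_congr rfl fun p _ ↦ ?_
          rw [Rat.cast_mul, ha p s, mul_comm]
      _ = 0 := by rw [this, Rat.cast_zero]

/-! ### §3 Non-degeneracy in `x`: a relation of minimal `x`-degree -/

/-- **`x̂` is not a constant**: `m(x̂) ≠ 0` in `ℂ((q))` for every nonzero `m ∈ ℂ[X]` (a root of `m` would make
`x̂ = β` constant, i.e. `F = β·G`, so `℘_Λ(u) ≡ β` high in the cusp — but `|℘_Λ(u(τ))| → ∞` there, tree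
`tendsto_norm_weierstrassP_eichlerIntegral_atTop`). [folklore] -/
theorem aeval_xFn_ne_zero {f : CuspForm (Gamma0 N) 2} {L : PeriodPair} {k : ℤ}
    {F G : CuspForm (Gamma0 N) k} (h : IsXPresentation f L F G) (hf : f ≠ 0) {m : Polynomial ℂ} (hm : m ≠ 0) :
    Polynomial.aeval ((h.xFn : modularFunctionField N) : LaurentSeries ℂ) m ≠ 0 := by
  classical
  set X : LaurentSeries ℂ := ((h.xFn : modularFunctionField N) : LaurentSeries ℂ) with hXdef
  intro h0
  -- a root `β` with `X = C β`
  rw [(IsAlgClosed.splits m).eq_prod_roots, map_mul, Polynomial.aeval_C,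
    map_multiset_prod, Multiset.map_map, mul_eq_zero] at h0
  rcases h0 with h0 | h0
  · exact (Polynomial.leadingCoeff_ne_zero.mpr hm) (by simpa [algebraMap_laurentSeries_apply] using h0)
  obtain ⟨β, -, hβ⟩ := Multiset.mem_map.mp (Multiset.prod_eq_zero_iff.mp h0)
  simp only [comp_apply, map_sub, Polynomial.aeval_X, Polynomial.aeval_C, algebraMap_laurentSeries_apply,
    sub_eq_zero] at hβ
  -- hence `F = β·G`
  have hu : X * qExpansionL N (G : ModularForm (Gamma0 N) k) = qExpansionL N (F : ModularForm (Gamma0 N) k) :=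
    mkFn_mul _ _ h.modularForm_ne_zero
  have hFG : (F : ModularForm (Gamma0 N) k) = β • (G : ModularForm (Gamma0 N) k) := by
    rw [← sub_eq_zero, ← qExpansionL_eq_zero_iff, ← neg_add_eq_sub, qExpansionL_add, qExpansionL_neg,
      qExpansionL_smul, ← hu, hβ, HahnSeries.C_mul_eq_smul, neg_add_eq_sub, sub_self]
  have hpt : ∀ τ : ℍ, F τ = β * G τ := fun τ ↦ by
    have := congrArg (fun H : ModularForm (Gamma0 N) k ↦ H τ) hFG
    simpa [IsGLPos.smul_apply] using this
  -- so `℘_Λ(u) = β` high in the cusp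
  have hG1 := isCuspFunction_one G
  have hG0 := qExpansion_ne_zero_of_ne_zero h.modularForm_ne_zero
  have hGev : ∀ᶠ τ : ℍ in atImInfty, G τ ≠ 0 :=
    eventually_ne_zero_atImInfty hG1.periodic hG1.mdifferentiable hG1.isBoundedAtImInfty hG0
  obtain ⟨T, hT⟩ := exists_forall_eichlerIntegral_smul_notMem f hf L 1
  have hT' : ∀ᶠ τ : ℍ in atImInfty, eichlerIntegral f τ ∉ L.lattice := by
    rw [atImInfty, Filter.eventually_comap]
    filter_upwards [Filter.eventually_ge_atTop T] with t ht τ hτ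
    have := hT τ (by rw [← hτ] at ht; exact ht)
    rwa [one_smul] at this
  have hev : (fun _ : ℍ ↦ β) =ᶠ[atImInfty] fun τ : ℍ ↦ ℘[L] (eichlerIntegral f τ) := by
    filter_upwards [hGev, hT'] with τ hGτ hτ
    have h1 := h.2 τ hτ
    rw [hpt τ] at h1
    exact (mul_right_cancel₀ hGτ h1).symm
  exact not_tendsto_of_tendsto_norm_atTop (tendsto_const_nhds.congr' hev)
    (tendsto_norm_weierstrassP_eichlerIntegral_atTop f hf L)

omit [NeZero N] in
/-- `Σ_{i ≤ e} C(tᵢ)·X̂ⁱ = t(x̂)` for `t ∈ ℚ[X]` of degree `≤ e` (viewed in `ℂ[X]`). [folklore] -/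
theorem sum_C_coeff_mul_pow_eq_aeval (X : LaurentSeries ℂ) {e : ℕ} (t : Polynomial ℚ) (ht : t.natDegree < e + 1) :
    ∑ i : Fin (e + 1), HahnSeries.C (((t.coeff i : ℚ)) : ℂ) * X ^ (i : ℕ) =
      Polynomial.aeval X (t.map (algebraMap ℚ ℂ)) := by
  have ht' : (t.map (algebraMap ℚ ℂ)).natDegree < e + 1 := (Polynomial.natDegree_map_le).trans_lt ht
  rw [Polynomial.aeval_eq_sum_range' ht', ← Fin.sum_univ_eq_sum_range]
  refine Finset.sum_congr rfl fun i _ ↦ ?_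
  rw [Polynomial.coeff_map, Algebra.smul_def, algebraMap_laurentSeries_apply, eq_ratCast]

omit [NeZero N] in
/-- Coefficients of `Σ_{i ≤ e} C(yᵢ)Xⁱ ∈ ℚ[X]`. [folklore] -/
theorem coeff_sum_C_mul_X_pow {e : ℕ} (y : Fin (e + 1) → ℚ) (i : Fin (e + 1)) :
    (∑ i' : Fin (e + 1), Polynomial.C (y i') * Polynomial.X ^ (i' : ℕ)).coeff i = y i := by
  rw [Polynomial.finsetSum_coeff]
  simp_rw [Polynomial.coeff_C_mul_X_pow]
  rw [Finset.sum_eq_single i (fun j _ hj ↦ if_neg (fun h ↦ hj (Fin.ext h.symm))) (by simp)]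
  simp

omit [NeZero N] in
/-- Degree of `Σ_{i ≤ e} C(yᵢ)Xⁱ`. [folklore] -/
theorem natDegree_sum_C_mul_X_pow_lt {e : ℕ} (y : Fin (e + 1) → ℚ) :
    (∑ i' : Fin (e + 1), Polynomial.C (y i') * Polynomial.X ^ (i' : ℕ)).natDegree < e + 1 := by
  refine Nat.lt_succ_of_le (Polynomial.natDegree_sum_le_of_forall_le _ _ fun i _ ↦ ?_)
  exact (Polynomial.natDegree_C_mul_X_pow_le _ _).trans (Nat.lt_succ_iff.mp i.is_lt)

/-- **A rational relation of minimal `x`-degree is non-degenerate in `x`**: for every `α ∈ ℂ` some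
`Σ_i y(i,k) αⁱ` is nonzero, i.e. `Φ(J, α) ≢ 0`. [cite: ShimuraIATAF1971, Prop. 2.11] -/
theorem exists_rat_relation_nondegenerate {f : CuspForm (Gamma0 N) 2} {L : PeriodPair} {k : ℤ}
    {F G : CuspForm (Gamma0 N) k} (h : IsXPresentation f L F G) (hf : f ≠ 0)
    (hrat : ∀ m, ∃ q : ℚ, (q : ℂ) = cuspCoeff f m) (hg₂ : ∃ q : ℚ, (q : ℂ) = L.g₂) (hg₃ : ∃ q : ℚ, (q : ℂ) = L.g₃) :
    ∃ (d D : ℕ) (y : Fin (d + 1) × Fin (D + 1) → ℚ), y ≠ 0 ∧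
      ∑ p : Fin (d + 1) × Fin (D + 1), HahnSeries.C ((y p : ℚ) : ℂ) *
        (kleinJL ^ (p.2 : ℕ) * ((h.xFn : modularFunctionField N) : LaurentSeries ℂ) ^ (p.1 : ℕ)) = 0 ∧
      ∀ α : ℂ, ∃ k : Fin (D + 1), ∑ i : Fin (d + 1), ((y (i, k) : ℚ) : ℂ) * α ^ (i : ℕ) ≠ 0 := by
  classical
  set X : LaurentSeries ℂ := ((h.xFn : modularFunctionField N) : LaurentSeries ℂ) with hXdef
  let P : ℕ → Prop := fun d ↦ ∃ (D : ℕ) (y : Fin (d + 1) × Fin (D + 1) → ℚ), y ≠ 0 ∧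
    ∑ p : Fin (d + 1) × Fin (D + 1), HahnSeries.C ((y p : ℚ) : ℂ) * (kleinJL ^ (p.2 : ℕ) * X ^ (p.1 : ℕ)) = 0
  have hP : ∃ d, P d := by
    obtain ⟨d, D, y, hy, hrel⟩ := exists_rat_relation h hf hrat hg₂ hg₃
    exact ⟨d, D, y, hy, hrel⟩
  set d₀ := Nat.find hP with hd₀
  obtain ⟨D, y, hy, hrel⟩ : P d₀ := Nat.find_spec hP
  refine ⟨d₀, D, y, hy, hrel, fun α ↦ ?_⟩
  by_contra hall
  push Not at hall
  -- the column polynomials `r k = Σ_i y(i,k) Xⁱ ∈ ℚ[X]`, all vanishing at `α`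
  set r : Fin (D + 1) → Polynomial ℚ := fun k' ↦ ∑ i : Fin (d₀ + 1), Polynomial.C (y (i, k')) * Polynomial.X ^ (i : ℕ)
    with hr
  have hr_aeval : ∀ k', Polynomial.aeval α (r k') = ∑ i : Fin (d₀ + 1), ((y (i, k') : ℚ) : ℂ) * α ^ (i : ℕ) := by
    intro k'
    simp only [hr, map_sum, map_mul, Polynomial.aeval_C, map_pow, Polynomial.aeval_X, eq_ratCast]
  have hr0 : ∀ k', Polynomial.aeval α (r k') = 0 := fun k' ↦ by rw [hr_aeval]; exact hall k'
  -- some column is nonzero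
  obtain ⟨⟨i₀, k₀⟩, hy0⟩ : ∃ p, y p ≠ 0 := by
    by_contra hnone
    push Not at hnone
    exact hy (funext hnone)
  have hrk0 : r k₀ ≠ 0 := fun h0 ↦ hy0 (by
    have := coeff_sum_C_mul_X_pow (fun i ↦ y (i, k₀)) i₀
    rw [show (∑ i' : Fin (d₀ + 1), Polynomial.C (y (i', k₀)) * Polynomial.X ^ (i' : ℕ)) = r k₀ from rfl, h0,
      Polynomial.coeff_zero] at this
    exact this.symm)
  -- `α` is algebraic; its minimal polynomial divides every column
  have hα' : IsAlgebraic ℚ α := ⟨r k₀, hrk0, hr0 k₀⟩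
  have hα : IsIntegral ℚ α := hα'.isIntegral
  have hm1 : 0 < (minpoly ℚ α).natDegree := minpoly.natDegree_pos hα
  have hdvd : ∀ k', minpoly ℚ α ∣ r k' := fun k' ↦ minpoly.dvd ℚ α (hr0 k')
  choose sq hsq using hdvd
  have hdeg_r : ∀ k', (r k').natDegree < d₀ + 1 := fun k' ↦ natDegree_sum_C_mul_X_pow_lt _
  have hsq0 : sq k₀ ≠ 0 := fun h0 ↦ hrk0 (by rw [hsq k₀, h0, mul_zero])
  have hdeg_sq : ∀ k', (sq k').natDegree + 1 ≤ d₀ := by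
    intro k'
    by_cases hs : sq k' = 0
    · rw [hs, Polynomial.natDegree_zero]
      have := Polynomial.natDegree_le_of_dvd ⟨sq k₀, hsq k₀⟩ hrk0
      have := hdeg_r k₀
      omega
    · have := Polynomial.natDegree_mul (minpoly.ne_zero hα) hs
      have h2 := hdeg_r k'
      rw [hsq k'] at h2
      omega
  have hd₀ : 1 ≤ d₀ := le_trans (Nat.succ_le_succ (Nat.zero_le _)) (hdeg_sq k₀)
  -- the smaller relation
  set d' := d₀ - 1 with hd'
  have hd'1 : d' + 1 = d₀ := by omega
  let y' : Fin (d' + 1) × Fin (D + 1) → ℚ := fun p ↦ (sq p.2).coeff p.1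
  have hy' : y' ≠ 0 := by
    intro h0
    have hlc : (sq k₀).leadingCoeff ≠ 0 := Polynomial.leadingCoeff_ne_zero.mpr hsq0
    have hlt : (sq k₀).natDegree < d' + 1 := by have := hdeg_sq k₀; omega
    have := congrFun h0 (⟨(sq k₀).natDegree, hlt⟩, k₀)
    exact hlc this
  -- the key factorisation `Σ_p C(y p) ĵᵏ x̂ⁱ = minpoly(x̂) · Σ_p C(y' p) ĵᵏ x̂ⁱ`
  have hsum : ∀ (e : ℕ) (t : Fin (D + 1) → Polynomial ℚ) (ht : ∀ k', (t k').natDegree < e + 1),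
      ∑ p : Fin (e + 1) × Fin (D + 1), HahnSeries.C ((((t p.2).coeff p.1 : ℚ)) : ℂ) *
        (kleinJL ^ (p.2 : ℕ) * X ^ (p.1 : ℕ)) =
      ∑ k' : Fin (D + 1), kleinJL ^ (k' : ℕ) * Polynomial.aeval X ((t k').map (algebraMap ℚ ℂ)) := by
    intro e t ht
    rw [Fintype.sum_prod_type_right]
    refine Finset.sum_congr rfl fun k' _ ↦ ?_
    rw [← sum_C_coeff_mul_pow_eq_aeval X (t k') (ht k'), Finset.mul_sum]
    refine Finset.sum_congr rfl fun i _ ↦ ?_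
    ring
  have hrel_r : ∑ p : Fin (d₀ + 1) × Fin (D + 1), HahnSeries.C ((y p : ℚ) : ℂ) *
      (kleinJL ^ (p.2 : ℕ) * X ^ (p.1 : ℕ)) =
      ∑ k' : Fin (D + 1), kleinJL ^ (k' : ℕ) * Polynomial.aeval X ((r k').map (algebraMap ℚ ℂ)) := by
    rw [← hsum d₀ r hdeg_r]
    refine Finset.sum_congr rfl fun p _ ↦ ?_
    rw [show (r p.2).coeff p.1 = y p from by
      rw [hr]; exact (coeff_sum_C_mul_X_pow (fun i ↦ y (i, p.2)) p.1)]
  have hrel' : Polynomial.aeval X ((minpoly ℚ α).map (algebraMap ℚ ℂ)) *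
      ∑ p : Fin (d' + 1) × Fin (D + 1), HahnSeries.C ((y' p : ℚ) : ℂ) *
        (kleinJL ^ (p.2 : ℕ) * X ^ (p.1 : ℕ)) = 0 := by
    rw [hsum d' (fun k' ↦ sq k') (fun k' ↦ by have := hdeg_sq k'; omega), Finset.mul_sum, ← hrel, hrel_r]
    refine Finset.sum_congr rfl fun k' _ ↦ ?_
    rw [hsq k', Polynomial.map_mul, map_mul]
    ring
  have hm0 : Polynomial.aeval X ((minpoly ℚ α).map (algebraMap ℚ ℂ)) ≠ 0 :=
    aeval_xFn_ne_zero h hf ((Polynomial.map_ne_zero_iff (algebraMap ℚ ℂ).injective).mpr (minpoly.ne_zero hα))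
  have hPd' : P d' := ⟨D, y', hy', (mul_eq_zero.mp hrel').resolve_left hm0⟩
  have := Nat.find_min hP (show d' < d₀ by omega)
  exact this hPd'

end Summit.BirchSwinnertonDyer.BirchSwinnertonDyer.Theorems.ManinLocalTwoThree.ParamPoleJ

end
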